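import Mathlib
import HarnessLib
import Summits.NavierStokesRegularity.NavierStokesRegularity.Theorems.LocalTraceTubeDoorTarget
import Summits.NavierStokesRegularity.NavierStokesRegularity.Theorems.LocalTraceTubeDoorHarmonicHeadTarget
import Summits.NavierStokesRegularity.NavierStokesRegularity.Theorems.LocalTraceTubeDoorHeadFamily

/-!
# The one-window door family — the `Π_λ`-DOORS, all real `λ`, PROVED:
# for every `λ`, Type-I blow-up needs `Δ(p + λ|u|²/2) ≢ 0` on every similarity window

Cell ns-regularity-ideate, seat p6 (route-directed support for nsreg-p1's door family; bears_on LADDER-NS N0; anchor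
`--supports stmt-NavierStokesRegularity-20018`, the profile-rigidity item of the family).  The DOOR for the
one-parameter family of second-order scalars `H_λ(u) = (λ−1) tr((Du)²) + λ(⟪u, Δu⟫ + |curl u|²) = Δ(p + λ|u|²/2)`
(profile crux = `…LocalTraceTubeDoorHeadFamily.headFamilyWindowRigidity`), assembled exactly as the `λ = 1` member
(`…HarmonicHeadTarget.targetHead`) from the second-order universal zoom `localPointZoomVelGradHessSlices` and the
window glue `windowFatou_secondOrder`, with `F_λ(x, A, B) = (λ−1) tr(A ∘ A) + λ(⟪x, Σᵢ B(eᵢ,eᵢ)⟫ + |curl A|²)`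
(homogeneous of weight `σ⁴ν²` under the glue's coupled scalings `(σν, σ²ν, σ³ν)`).

**`targetHeadFamily lam`**: a classical Leray–Hopf flow from rapidly decaying data that is locally Type I at `(x₀, T)`
and whose scale-invariant density `(T−t)²·H_λ(u)(t, x₀ + √(T−t)y)` fades in `L¹` on ONE nonempty open similarity window
is backward bounded at `x₀` — for EVERY real `λ` (`λ = 0`: door S14, `…LocalTraceTubeDoorTarget.target`, stated there
with the first-order zoom; `λ = 1`: the harmonic-head / Lamb-divergence door).

WHAT THIS IS NOT: not a claim about Navier–Stokes regularity (Clay A) — a one-parameter family of local regularity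
CRITERIA conditional on local Type I (bears_on LADDER-NS N0, door family); establishment in the cell's sense still
requires the cross-family referee PASS + independent reproduction.
-/

noncomputable section

-- the summit and its single sub-problem share the name (CONVENTIONS §1), as in every Theorems file
set_option linter.dupNamespace false

namespace Summit.NavierStokesRegularity.NavierStokesRegularity.Theorems.LocalTraceTubeDoorHeadFamilyTarget

open MeasureTheory Set Function Filter Topology TopologicalSpace Metric
open scoped RealInnerProductSpace InnerProductSpace NNReal ENNReal Laplacian
open Literature.Analysis Literature.Analysis.FluidPDE
open Summit.NavierStokesRegularity.NavierStokesRegularity.Theorems.LocalSineTubeDoorLocalPointZoomHessSlices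
open Summit.NavierStokesRegularity.NavierStokesRegularity.Theorems.LocalSineTubeDoorWindowFatouSecondOrder
open Summit.NavierStokesRegularity.NavierStokesRegularity.Theorems.LocalTraceTubeDoorTarget
open Summit.NavierStokesRegularity.NavierStokesRegularity.Theorems.LocalTraceTubeDoorHarmonicHeadTarget
open Summit.NavierStokesRegularity.NavierStokesRegularity.Theorems.LocalTraceTubeDoorHeadFamily

/-- **THE `Π_λ`-DOOR, every real `λ`.**  See the module docstring. -/
theorem targetHeadFamily (lam : ℝ) :
    ∀ (ν T : ℝ), 0 < ν → 0 < T → ∀ (u : ℝ → EuclideanSpace ℝ (Fin 3) → EuclideanSpace ℝ (Fin 3))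
      (p : ℝ → EuclideanSpace ℝ (Fin 3) → ℝ),
    Literature.Analysis.FluidPDE.IsClassicalNSSolutionOn (Set.Ico 0 T) ν 0 u p →
    Literature.Analysis.FluidPDE.IsLerayHopfOn T ν 0 (u 0) u →
    Literature.Analysis.FluidPDE.HasRapidSpatialDecay (u 0) →
    ∀ (x₀ : EuclideanSpace ℝ (Fin 3)) (ρ M : ℝ), 0 < ρ →
    (∀ t ∈ Set.Ico 0 T, T - ρ ^ 2 < t → ∀ x ∈ Metric.ball x₀ ρ, ‖u t x‖ * Real.sqrt (ν * (T - t)) ≤ M) →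
    ∀ (U : Set (EuclideanSpace ℝ (Fin 3))), IsOpen U → U.Nonempty →
    Filter.Tendsto (fun t => ∫⁻ y in U, ENNReal.ofReal
        |(T - t) ^ 2 * ((lam - 1) * LinearMap.trace ℝ (EuclideanSpace ℝ (Fin 3))
            (((fderiv ℝ (u t) (x₀ + Real.sqrt (T - t) • y)).comp (fderiv ℝ (u t) (x₀ + Real.sqrt (T - t) • y))) :
              EuclideanSpace ℝ (Fin 3) →ₗ[ℝ] EuclideanSpace ℝ (Fin 3)) +
          lam * (⟪u t (x₀ + Real.sqrt (T - t) • y), (Δ (u t)) (x₀ + Real.sqrt (T - t) • y)⟫_ℝ +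
            ‖Literature.Analysis.FluidPDE.curl (u t) (x₀ + Real.sqrt (T - t) • y)‖ ^ 2))|)
      (nhdsWithin T (Set.Iio T)) (nhds 0) →
    Literature.Analysis.FluidPDE.IsBackwardBoundedAt u T x₀ := by
  intro ν T hν hT u p hcl hLH hdec x₀ ρ M hρ hM U hU hUne hfade
  by_contra hnot
  obtain ⟨C, v, lamj, hlam, hlam0, ⟨hrate, hcont, hmild, hdiv⟩, hsing, hconv⟩ :=
    localPointZoomVelGradHessSlices ν T hν hT u p hcl hLH hdec x₀ ρ M hρ hM hnot
  -- the `Π_λ` scalar in `F(x, A, B)` form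
  set F : EuclideanSpace ℝ (Fin 3) → (EuclideanSpace ℝ (Fin 3) →L[ℝ] EuclideanSpace ℝ (Fin 3)) →
      ContinuousMultilinearMap ℝ (fun _ : Fin 2 => EuclideanSpace ℝ (Fin 3)) (EuclideanSpace ℝ (Fin 3)) → ℝ :=
    fun x A B => (lam - 1) * LinearMap.trace ℝ (EuclideanSpace ℝ (Fin 3))
        ((A.comp A : EuclideanSpace ℝ (Fin 3) →L[ℝ] EuclideanSpace ℝ (Fin 3)) :
          EuclideanSpace ℝ (Fin 3) →ₗ[ℝ] EuclideanSpace ℝ (Fin 3)) +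
      lam * (⟪x, ∑ i, B ![(stdOrthonormalBasis ℝ (EuclideanSpace ℝ (Fin 3))) i,
        (stdOrthonormalBasis ℝ (EuclideanSpace ℝ (Fin 3))) i]⟫_ℝ + ‖curlCLM A‖ ^ 2) with hF
  have hFc : Continuous fun q : EuclideanSpace ℝ (Fin 3) × (EuclideanSpace ℝ (Fin 3) →L[ℝ] EuclideanSpace ℝ (Fin 3)) ×
      ContinuousMultilinearMap ℝ (fun _ : Fin 2 => EuclideanSpace ℝ (Fin 3)) (EuclideanSpace ℝ (Fin 3)) =>
      F q.1 q.2.1 q.2.2 := by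
    have h1 := continuous_traceSq.comp (continuous_fst.prodMk (continuous_fst.comp continuous_snd) :
      Continuous fun q : EuclideanSpace ℝ (Fin 3) × (EuclideanSpace ℝ (Fin 3) →L[ℝ] EuclideanSpace ℝ (Fin 3)) ×
        ContinuousMultilinearMap ℝ (fun _ : Fin 2 => EuclideanSpace ℝ (Fin 3)) (EuclideanSpace ℝ (Fin 3)) =>
        (q.1, q.2.1))
    have h2 := continuous_headScalar
    exact (continuous_const.mul h1).add (continuous_const.mul h2)
  -- the fading hypothesis in `F` form
  have hfade' : Tendsto (fun t => ∫⁻ y in U, ENNReal.ofReal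
      |F (Real.sqrt (T - t) • u t (x₀ + Real.sqrt (T - t) • y))
        (Real.sqrt (T - t) ^ 2 • fderiv ℝ (u t) (x₀ + Real.sqrt (T - t) • y))
        (Real.sqrt (T - t) ^ 3 • iteratedFDeriv ℝ 2 (u t) (x₀ + Real.sqrt (T - t) • y))|) (𝓝[<] T) (𝓝 0) := by
    have hev : ∀ᶠ t in 𝓝[<] T, t < T := eventually_nhdsWithin_of_forall fun t ht => ht
    refine hfade.congr' (hev.mono fun t ht => ?_)
    refine lintegral_congr fun y => ?_
    have hs : 0 ≤ T - t := (sub_pos.2 ht).le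
    congr 2
    rw [hF]
    dsimp only
    rw [trace_smul_comp_smul, headScalar_smul, sum_iteratedFDeriv_two_eq_laplacian, curlCLM_fderiv]
    have e1 : Real.sqrt (T - t) * Real.sqrt (T - t) ^ 3 = (T - t) ^ 2 := by
      rw [← pow_succ', show (3 + 1 : ℕ) = 2 * 2 by norm_num, pow_mul, Real.sq_sqrt hs]
    have e2 : (Real.sqrt (T - t) ^ 2) ^ 2 = (T - t) ^ 2 := by rw [Real.sq_sqrt hs]
    rw [e1, e2]
    ring
  refine headFamilyWindowRigidity lam C v hrate hcont hmild hdiv (fun s hs => ?_) hsing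
  have hns : 0 < -s := neg_pos.2 hs
  set σ : ℝ := Real.sqrt (-s) / Real.sqrt ν with hσ
  have hσpos : 0 < σ := div_pos (Real.sqrt_pos.2 hns) (Real.sqrt_pos.2 hν)
  refine ⟨(fun z => σ⁻¹ • z) ⁻¹' U, hU.preimage (continuous_const_smul σ⁻¹), ?_, fun z hz => ?_⟩
  · obtain ⟨u₀, hu₀⟩ := hUne
    refine ⟨σ • u₀, ?_⟩
    show σ⁻¹ • (σ • u₀) ∈ U
    rwa [smul_smul, inv_mul_cancel₀ hσpos.ne', one_smul]
  · have hz' : σ⁻¹ • z ∈ U := hz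
    have h0 := windowFatou_secondOrder hν hT hcl hlam hlam0 hrate hcont hmild hconv F hFc hU hfade' hs hz'
    rw [← hσ, smul_inv_smul₀ hσpos.ne', hF] at h0
    dsimp only at h0
    rw [trace_smul_comp_smul, headScalar_smul, sum_iteratedFDeriv_two_eq_laplacian, curlCLM_fderiv] at h0
    have hpos : 0 < (σ ^ 2 * ν) ^ 2 := by positivity
    have e : σ * ν * (σ ^ 3 * ν) = (σ ^ 2 * ν) ^ 2 := by ring
    rw [e] at h0
    have h1 : (σ ^ 2 * ν) ^ 2 * ((lam - 1) * LinearMap.trace ℝ (EuclideanSpace ℝ (Fin 3))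
        (((fderiv ℝ (v s) z).comp (fderiv ℝ (v s) z)) : EuclideanSpace ℝ (Fin 3) →ₗ[ℝ] EuclideanSpace ℝ (Fin 3)) +
        lam * (⟪v s z, (Δ (v s)) z⟫_ℝ + ‖curl (v s) z‖ ^ 2)) = 0 := by
      rw [← h0]; ring
    rcases mul_eq_zero.1 h1 with h | h
    · exact absurd h hpos.ne'
    · exact h

end Summit.NavierStokesRegularity.NavierStokesRegularity.Theorems.LocalTraceTubeDoorHeadFamilyTarget

end
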